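import Literature.Computability.QuantumComplexity.ForrelationDerivativeTables
import Literature.Computability.QuantumComplexity.ForrelationDirectSum

/-!
# Crux `CubicForrelation.NearExactIsExact` (stmt-QuantumAdvantage-14043) — the averaging identity under 4-concatenation

Line `direct-sum-amplification`, support for the OPEN band stubs (`stub_bentSidedBand`, `stub_nonBentBand`).
A second exact operation on forrelation values besides the direct sum (`forrelation_directSum`: values
MULTIPLY): the **4-concatenation** `F = c ‖ d₁ ‖ d₁ ‖ ¬c`, `G = g₁ ‖ g₂ ‖ g₂ ‖ ¬g₁` on `n + 2` bits, i.e.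

  `F(x, a, b) = c(x) ⊕ (a ⊕ b)·(c(x) ⊕ d₁(x)) ⊕ a·b`,  `G(y, a, b) = g₁(y) ⊕ (a ⊕ b)·(g₁(y) ⊕ g₂(y)) ⊕ a·b`,

satisfies, for ALL Boolean `c, d₁, g₁, g₂` on `n` bits (no bentness, no degree hypothesis),

  `Φ(F, G) = (Φ(d₁, g₁) + Φ(c, g₂)) / 2`            (`bb_forrelation_concat`).

(The `2 + 2` extra bits contribute the `16`-term block sum `4(-1)^{d₁(x)+g₁(y)} + 4(-1)^{c(x)+g₂(y)}`,
`bb_block_sum`, and `√(2^{3·2}) = 8`.) Degrees: `G` is cubic iff `g₁` is cubic and `g₁ ⊕ g₂` is QUADRATIC;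
`F` is cubic iff `c` is cubic and `c ⊕ d₁` is quadratic (`bb_isDegLeFun_concat`). Hence the cubic value set
`𝒞` is closed under AVERAGING over "quadratically adjacent" pairs of pairs. The Walsh transform of `G` is
`W_G(u,a,b) = W_{g₁}(u)(1 − (-1)^{a+b}) + W_{g₂}(u)((-1)^a + (-1)^b)` (`bb_W_concat`), so `G` is bent iff `g₁, g₂`
are, with dual `g̃₂ ‖ g̃₁ ‖ g̃₁ ‖ ¬g̃₂` (`bb_W_concat_of_duals`, in the `W = 2^m·(-1)^d` vocabulary of the band stubs).
In particular:

* if `(d₁, g₁)` is an EXACT cubic pair (`Φ = 1`; `g₁` bent with cubic dual `d₁`) and `(c, g₂)` is a cubic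
  pair with `c ≡ d₁`, `g₂ ≡ g₁ (mod RM(2,n))`, then `(1 + Φ(c, g₂))/2 ∈ 𝒞` on `n + 2` bits
  (`bb_forrelation_concat_of_exact`) — the defect `1 − Φ` is HALVED. So the crux `NearExactIsExact` with
  threshold `θ` forces `Φ(c, g₂) ∈ {1} ∪ [−1, 2θ − 1]` for every cubic pair quadratically adjacent to an exact
  cubic pair; a near-top value adjacent to an exact pair is the first rung of a would-be ladder
  `1 − 2^{−k}(1 − Φ)` (every further rung needs a fresh exact partner, quadratically adjacent at the new level).
  For the bent branch: with `g₂` bent, `1 − Φ(F,G) = dist(c, g̃₂)/2ⁿ` where `c` ranges over the cubics in the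
  coset `d₁ + RM(2,n)` only — the residual `R_bent` at level `n + 2` for such `G` is a statement about
  quadruples at level `n`.

This is the classical secondary construction `f ‖ g ‖ g ‖ f ⊕ 1` of bent functions (bent iff `f, g` bent, dual
`g̃ ‖ f̃ ‖ f̃ ‖ g̃ ⊕ 1`; see the secondary constructions in C. Carlet, Boolean Functions for Cryptography and
Coding Theory, CUP 2021, §6.1, and A. Canteaut, P. Charpin, Decomposing bent functions, IEEE Trans. Inform.
Theory 49 (2003)) read at the level of forrelation values; here it is simply computed from the definition of `Φ`
(S. Aaronson, A. Ambainis, Forrelation, SIAM J. Comput. 47 (2018) §1.1.1). Everything below is a theorem, axioms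
standard.

Imports: only the `Literature` forrelation files (they bring `forrelation`, `IsDegLeFun`, `signOf`, `twist`,
`DerivativeWalsh.W`); the Theses file `Summits.…Theses.CubicForrelation` is deliberately NOT imported (nothing here
needs the crux declarations), so this module does not depend on route edits of the Theses file.
-/

set_option linter.dupNamespace false -- D-0017: single-problem summit

namespace Summit.QuantumAdvantage.QuantumAdvantage.Theorems.CubicForrelation.NearExactIsExact

open Finset
open Literature.Computability.QuantumComplexity

variable {n : ℕ}

/-- A sum over `Fin 2 → Bool` is the sum over the four vectors `![a, b]`. -/
theorem bb_sum_fin_two (H : (Fin 2 → Bool) → ℝ) :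
    ∑ v, H v = H ![false, false] + H ![true, false] + H ![false, true] + H ![true, true] := by
  rw [← (finTwoArrowEquiv Bool).symm.sum_comp, Fintype.sum_prod_type]
  simp only [Fintype.sum_bool, finTwoArrowEquiv_symm_apply]
  ring

/-- The twist of two explicit `2`-bit vectors. -/
theorem bb_twist_fin_two (a b a' b' : Bool) :
    twist ![a, b] ![a', b'] = (if (a && a') = true then (-1 : ℝ) else 1) * (if (b && b') = true then (-1 : ℝ) else 1) := by
  unfold twist
  rw [Fin.prod_univ_two]
  simp

/-- **The `16`-term block sum** of the 4-concatenation: for Booleans `p = c(x)`, `q = d₁(x)`, `r = g₁(y)`,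
`s = g₂(y)`, `Σ_{a b a' b'} (-1)^{F-block} (-1)^{(a,b)·(a',b')} (-1)^{G-block} = 4(-1)^{q+r} + 4(-1)^{p+s}`. -/
theorem bb_block_sum (p q r s : Bool) :
    ∑ x₂ : Fin 2 → Bool, ∑ y₂ : Fin 2 → Bool,
      signOf (xor (xor p ((xor (x₂ 0) (x₂ 1)) && (xor p q))) (x₂ 0 && x₂ 1)) * twist x₂ y₂ *
        signOf (xor (xor r ((xor (y₂ 0) (y₂ 1)) && (xor r s))) (y₂ 0 && y₂ 1)) =
      4 * (signOf q * signOf r) + 4 * (signOf p * signOf s) := by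
  rw [bb_sum_fin_two]
  simp only [bb_sum_fin_two, bb_twist_fin_two, Matrix.cons_val_zero, Matrix.cons_val_one]
  cases p <;> cases q <;> cases r <;> cases s <;> simp [signOf] <;> norm_num

/-- `√(2^{3·2}) = 8`. -/
theorem bb_sqrt_two_pow_six : Real.sqrt ((2 : ℝ) ^ (3 * 2)) = 8 := by
  rw [show (2 : ℝ) ^ (3 * 2) = 8 ^ 2 by norm_num]
  exact Real.sqrt_sq (by norm_num)

/-- **The averaging identity under 4-concatenation.** For ALL Boolean `c, d₁, g₁, g₂` on `n` bits, the pair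
`F(x,a,b) = c(x) ⊕ (a ⊕ b)(c ⊕ d₁)(x) ⊕ ab`, `G(y,a,b) = g₁(y) ⊕ (a ⊕ b)(g₁ ⊕ g₂)(y) ⊕ ab` on `n + 2` bits
(the concatenations `c ‖ d₁ ‖ d₁ ‖ ¬c` and `g₁ ‖ g₂ ‖ g₂ ‖ ¬g₁`) has
`Φ(F, G) = (Φ(d₁, g₁) + Φ(c, g₂))/2`. (The bent-function construction `f ‖ g ‖ g ‖ f ⊕ 1` of Carlet 2021 §6.1,
read at the level of forrelation values; a direct computation from the definition of `Φ`.) -/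
theorem bb_forrelation_concat :
    ∀ {n : ℕ} (c d₁ g₁ g₂ : (Fin n → Bool) → Bool), forrelation (n := n + 2)
        (fun x => xor (xor (c fun i => x (Fin.castAdd 2 i))
          ((xor (x (Fin.natAdd n 0)) (x (Fin.natAdd n 1))) &&
            (xor (c fun i => x (Fin.castAdd 2 i)) (d₁ fun i => x (Fin.castAdd 2 i)))))
          (x (Fin.natAdd n 0) && x (Fin.natAdd n 1)))
        (fun y => xor (xor (g₁ fun i => y (Fin.castAdd 2 i))
          ((xor (y (Fin.natAdd n 0)) (y (Fin.natAdd n 1))) &&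
            (xor (g₁ fun i => y (Fin.castAdd 2 i)) (g₂ fun i => y (Fin.castAdd 2 i)))))
          (y (Fin.natAdd n 0) && y (Fin.natAdd n 1))) =
      (forrelation d₁ g₁ + forrelation c g₂) / 2 := by
  intro n c d₁ g₁ g₂
  unfold forrelation
  rw [sqrt_two_pow_three_mul_add, bb_sqrt_two_pow_six]
  simp_rw [sum_append]
  simp only [Fin.append_left, Fin.append_right, twist_append]
  have key : ∀ (x₁ y₁ : Fin n → Bool),
      ∑ x₂ : Fin 2 → Bool, ∑ y₂ : Fin 2 → Bool,
        signOf (xor (xor (c x₁) ((xor (x₂ 0) (x₂ 1)) && (xor (c x₁) (d₁ x₁)))) (x₂ 0 && x₂ 1)) *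
          (twist x₁ y₁ * twist x₂ y₂) *
          signOf (xor (xor (g₁ y₁) ((xor (y₂ 0) (y₂ 1)) && (xor (g₁ y₁) (g₂ y₁)))) (y₂ 0 && y₂ 1)) =
      twist x₁ y₁ * (4 * (signOf (d₁ x₁) * signOf (g₁ y₁)) + 4 * (signOf (c x₁) * signOf (g₂ y₁))) := by
    intro x₁ y₁
    rw [← bb_block_sum, mul_sum]
    refine sum_congr rfl fun x₂ _ => ?_
    rw [mul_sum]
    refine sum_congr rfl fun y₂ _ => ?_
    ring
  have swap : ∀ x₁ : Fin n → Bool,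
      ∑ x₂ : Fin 2 → Bool, ∑ y₁ : Fin n → Bool, ∑ y₂ : Fin 2 → Bool,
        signOf (xor (xor (c x₁) ((xor (x₂ 0) (x₂ 1)) && (xor (c x₁) (d₁ x₁)))) (x₂ 0 && x₂ 1)) *
          (twist x₁ y₁ * twist x₂ y₂) *
          signOf (xor (xor (g₁ y₁) ((xor (y₂ 0) (y₂ 1)) && (xor (g₁ y₁) (g₂ y₁)))) (y₂ 0 && y₂ 1)) =
      ∑ y₁ : Fin n → Bool, twist x₁ y₁ *
        (4 * (signOf (d₁ x₁) * signOf (g₁ y₁)) + 4 * (signOf (c x₁) * signOf (g₂ y₁))) := by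
    intro x₁
    rw [sum_comm]
    exact sum_congr rfl fun y₁ _ => key x₁ y₁
  simp_rw [swap]
  have split : ∑ x₁ : Fin n → Bool, ∑ y₁ : Fin n → Bool, twist x₁ y₁ *
        (4 * (signOf (d₁ x₁) * signOf (g₁ y₁)) + 4 * (signOf (c x₁) * signOf (g₂ y₁))) =
      4 * (∑ x₁ : Fin n → Bool, ∑ y₁ : Fin n → Bool, signOf (d₁ x₁) * twist x₁ y₁ * signOf (g₁ y₁)) +
      4 * (∑ x₁ : Fin n → Bool, ∑ y₁ : Fin n → Bool, signOf (c x₁) * twist x₁ y₁ * signOf (g₂ y₁)) := by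
    rw [mul_sum, mul_sum, ← sum_add_distrib]
    refine sum_congr rfl fun x₁ _ => ?_
    rw [mul_sum, mul_sum, ← sum_add_distrib]
    refine sum_congr rfl fun y₁ _ => ?_
    ring
  rw [split]
  have h1 : Real.sqrt ((2 : ℝ) ^ (3 * n)) ≠ 0 := by positivity
  field_simp
  ring

/-- **Halving the defect next to an exact pair.** If `(d₁, g₁)` is exactly forrelated (`Φ = 1`: `g₁` bent with
dual `d₁`) then the 4-concatenated pair has `Φ(F, G) = (1 + Φ(c, g₂))/2`, i.e. `1 − Φ(F,G) = (1 − Φ(c,g₂))/2`.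
With `g₁, c` cubic and `g₁ ⊕ g₂`, `c ⊕ d₁` quadratic all four of `F, G, c, g₂` are cubic
(`bb_isDegLeFun_concat`), so a cubic pair with value `ρ` that is quadratically adjacent to an exact cubic pair
puts `(1 + ρ)/2` into the cubic value set. -/
theorem bb_forrelation_concat_of_exact (c d₁ g₁ g₂ : (Fin n → Bool) → Bool) (h : forrelation d₁ g₁ = 1) :
    forrelation (n := n + 2)
        (fun x => xor (xor (c fun i => x (Fin.castAdd 2 i))
          ((xor (x (Fin.natAdd n 0)) (x (Fin.natAdd n 1))) &&
            (xor (c fun i => x (Fin.castAdd 2 i)) (d₁ fun i => x (Fin.castAdd 2 i)))))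
          (x (Fin.natAdd n 0) && x (Fin.natAdd n 1)))
        (fun y => xor (xor (g₁ fun i => y (Fin.castAdd 2 i))
          ((xor (y (Fin.natAdd n 0)) (y (Fin.natAdd n 1))) &&
            (xor (g₁ fun i => y (Fin.castAdd 2 i)) (g₂ fun i => y (Fin.castAdd 2 i)))))
          (y (Fin.natAdd n 0) && y (Fin.natAdd n 1))) =
      (1 + forrelation c g₂) / 2 := by
  rw [bb_forrelation_concat, h]

/-! ### Degrees of the 4-concatenation -/

/-- `[a + b = 1] = [a = 1] ⊕ [b = 1]` and `[a·b = 1] = [a = 1] ∧ [b = 1]` in `𝔽₂`, as `polyPhase` identities. -/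
theorem bb_polyPhase_add_mul {k : ℕ} (p q : MvPolynomial (Fin k) (ZMod 2)) (x : Fin k → Bool) :
    polyPhase (p + q) x = xor (polyPhase p x) (polyPhase q x) ∧
      polyPhase (p * q) x = (polyPhase p x && polyPhase q x) := by
  have k₁ : ∀ a b : ZMod 2, decide (a + b = 1) = xor (decide (a = 1)) (decide (b = 1)) := by decide
  have k₂ : ∀ a b : ZMod 2, decide (a * b = 1) = (decide (a = 1) && decide (b = 1)) := by decide
  refine ⟨?_, ?_⟩
  · rw [polyPhase_apply, polyPhase_apply, polyPhase_apply, map_add]; exact k₁ _ _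
  · rw [polyPhase_apply, polyPhase_apply, polyPhase_apply, map_mul]; exact k₂ _ _

/-- Degree `≤ d` is closed under `⊕`. -/
theorem bb_deg_xor {k d : ℕ} {f g : (Fin k → Bool) → Bool} (hf : IsDegLeFun d f) (hg : IsDegLeFun d g) :
    IsDegLeFun d (fun x => xor (f x) (g x)) := by
  obtain ⟨p, hp, hpf⟩ := hf
  obtain ⟨q, hq, hqg⟩ := hg
  refine ⟨p + q, (MvPolynomial.totalDegree_add p q).trans (max_le hp hq), fun x => ?_⟩
  show xor (f x) (g x) = _
  rw [(bb_polyPhase_add_mul p q x).1, ← hpf, ← hqg]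

/-- Degrees add under `∧`. -/
theorem bb_deg_and {k a b d : ℕ} {f g : (Fin k → Bool) → Bool} (hf : IsDegLeFun a f) (hg : IsDegLeFun b g)
    (h : a + b ≤ d) : IsDegLeFun d (fun x => f x && g x) := by
  obtain ⟨p, hp, hpf⟩ := hf
  obtain ⟨q, hq, hqg⟩ := hg
  refine ⟨p * q, (MvPolynomial.totalDegree_mul p q).trans ((Nat.add_le_add hp hq).trans h), fun x => ?_⟩
  show (f x && g x) = _
  rw [(bb_polyPhase_add_mul p q x).2, ← hpf, ← hqg]

/-- Coordinates have degree `≤ 1`. -/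
theorem bb_deg_coord {k : ℕ} (j : Fin k) : IsDegLeFun 1 (fun x : Fin k → Bool => x j) :=
  isDegLeFun_apply j le_rfl

/-- Lifting a function of the first `n` of `n + 2` bits keeps its degree (rename the variables). -/
theorem bb_deg_lift {d : ℕ} {f : (Fin n → Bool) → Bool} (hf : IsDegLeFun d f) :
    IsDegLeFun d (fun x : Fin (n + 2) → Bool => f fun i => x (Fin.castAdd 2 i)) := by
  obtain ⟨p, hp, hpf⟩ := hf
  refine ⟨MvPolynomial.rename (Fin.castAdd 2) p, (MvPolynomial.totalDegree_rename_le _ _).trans hp, fun x => ?_⟩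
  show f (fun i => x (Fin.castAdd 2 i)) = _
  rw [hpf]
  simp only [polyPhase_apply, MvPolynomial.eval_rename, Function.comp_def]

/-- **Degree of the 4-concatenation**: if `g₁` has degree `≤ 3` and `g₁ ⊕ g₂` has degree `≤ 2` then
`G(y,a,b) = g₁(y) ⊕ (a ⊕ b)(g₁ ⊕ g₂)(y) ⊕ ab` has degree `≤ 3` (the same lemma serves `F` with `c`, `d₁`). -/
theorem bb_isDegLeFun_concat {g₁ g₂ : (Fin n → Bool) → Bool} (h₁ : IsDegLeFun 3 g₁)
    (h₁₂ : IsDegLeFun 2 (fun y => xor (g₁ y) (g₂ y))) :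
    IsDegLeFun 3 (fun y : Fin (n + 2) → Bool => xor (xor (g₁ fun i => y (Fin.castAdd 2 i))
          ((xor (y (Fin.natAdd n 0)) (y (Fin.natAdd n 1))) &&
            (xor (g₁ fun i => y (Fin.castAdd 2 i)) (g₂ fun i => y (Fin.castAdd 2 i)))))
          (y (Fin.natAdd n 0) && y (Fin.natAdd n 1))) := by
  have hA : IsDegLeFun 3 (fun y : Fin (n + 2) → Bool => g₁ fun i => y (Fin.castAdd 2 i)) := bb_deg_lift h₁
  have hB : IsDegLeFun 1 (fun y : Fin (n + 2) → Bool => xor (y (Fin.natAdd n 0)) (y (Fin.natAdd n 1))) :=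
    bb_deg_xor (bb_deg_coord _) (bb_deg_coord _)
  have hC : IsDegLeFun 2 (fun y : Fin (n + 2) → Bool =>
      xor (g₁ fun i => y (Fin.castAdd 2 i)) (g₂ fun i => y (Fin.castAdd 2 i))) := bb_deg_lift h₁₂
  have hD : IsDegLeFun 3 (fun y : Fin (n + 2) → Bool => y (Fin.natAdd n 0) && y (Fin.natAdd n 1)) :=
    bb_deg_and (bb_deg_coord _) (bb_deg_coord _) (by norm_num)
  exact bb_deg_xor (bb_deg_xor hA (bb_deg_and hB hC le_rfl)) hD

/-! ### Bentness and the dual of the 4-concatenation (in the `W`-vocabulary of the band stubs) -/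

/-- The twist against an explicit `2`-bit vector on the left. -/
theorem bb_twist_fin_two_left (a b : Bool) (v : Fin 2 → Bool) :
    twist ![a, b] v = (if (a && v 0) = true then (-1 : ℝ) else 1) * (if (b && v 1) = true then (-1 : ℝ) else 1) := by
  unfold twist
  rw [Fin.prod_univ_two]
  simp

/-- **Walsh transform of the 4-concatenation.** For ALL Boolean `g₁, g₂` on `n` bits and every `z` on `n + 2`
bits, writing `u = z|ₙ`, `a = z(n)`, `b = z(n+1)`:
`W_G(z) = W_{g₁}(u)·(1 − (-1)^{a+b}) + W_{g₂}(u)·((-1)^a + (-1)^b)` for `G = g₁ ‖ g₂ ‖ g₂ ‖ ¬g₁`. -/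
theorem bb_W_concat (g₁ g₂ : (Fin n → Bool) → Bool) (z : Fin (n + 2) → Bool) :
    DerivativeWalsh.W (fun y : Fin (n + 2) → Bool => signOf (xor (xor (g₁ fun i => y (Fin.castAdd 2 i))
          ((xor (y (Fin.natAdd n 0)) (y (Fin.natAdd n 1))) &&
            (xor (g₁ fun i => y (Fin.castAdd 2 i)) (g₂ fun i => y (Fin.castAdd 2 i)))))
          (y (Fin.natAdd n 0) && y (Fin.natAdd n 1)))) z =
      DerivativeWalsh.W (fun y => signOf (g₁ y)) (fun i => z (Fin.castAdd 2 i)) *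
          (1 - (if z (Fin.natAdd n 0) = true then (-1 : ℝ) else 1) * (if z (Fin.natAdd n 1) = true then (-1 : ℝ) else 1)) +
        DerivativeWalsh.W (fun y => signOf (g₂ y)) (fun i => z (Fin.castAdd 2 i)) *
          ((if z (Fin.natAdd n 0) = true then (-1 : ℝ) else 1) + (if z (Fin.natAdd n 1) = true then (-1 : ℝ) else 1)) := by
  unfold DerivativeWalsh.W
  conv_lhs => rw [← Fin.append_castAdd_natAdd (f := z)]
  rw [sum_append]
  simp only [Fin.append_left, Fin.append_right, twist_append]
  simp_rw [bb_sum_fin_two]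
  simp only [Matrix.cons_val_zero, Matrix.cons_val_one, bb_twist_fin_two_left]
  rw [sum_mul, sum_mul, ← sum_add_distrib]
  refine sum_congr rfl fun y₁ _ => ?_
  generalize z (Fin.natAdd n 0) = a
  generalize z (Fin.natAdd n 1) = b
  cases a <;> cases b <;> cases g₁ y₁ <;> cases g₂ y₁ <;> simp [signOf] <;> ring

/-- **The 4-concatenation of two bent functions is bent, with dual `d₂ ‖ d₁ ‖ d₁ ‖ ¬d₂`**, in the
`W`-vocabulary of the band stubs: if `W_{g₁} = K·(-1)^{d₁}` and `W_{g₂} = K·(-1)^{d₂}` pointwise (for bent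
`gᵢ` on `m + m` bits, `K = 2^m`), then `W_G(z) = 2K · (-1)^{D(z)}` with
`D(u,a,b) = d₂(u) ⊕ (a ⊕ b)(d₁ ⊕ d₂)(u) ⊕ ab`. So along quadratic adjacency the bent side is preserved and the
new dual is the concatenation of the old duals in swapped order (Carlet 2021 §6.1). -/
theorem bb_W_concat_of_duals (g₁ g₂ d₁ d₂ : (Fin n → Bool) → Bool) (K : ℝ)
    (h₁ : ∀ u, DerivativeWalsh.W (fun y => signOf (g₁ y)) u = K * signOf (d₁ u))
    (h₂ : ∀ u, DerivativeWalsh.W (fun y => signOf (g₂ y)) u = K * signOf (d₂ u))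
    (z : Fin (n + 2) → Bool) :
    DerivativeWalsh.W (fun y : Fin (n + 2) → Bool => signOf (xor (xor (g₁ fun i => y (Fin.castAdd 2 i))
          ((xor (y (Fin.natAdd n 0)) (y (Fin.natAdd n 1))) &&
            (xor (g₁ fun i => y (Fin.castAdd 2 i)) (g₂ fun i => y (Fin.castAdd 2 i)))))
          (y (Fin.natAdd n 0) && y (Fin.natAdd n 1)))) z =
      2 * K * signOf (xor (xor (d₂ fun i => z (Fin.castAdd 2 i))
          ((xor (z (Fin.natAdd n 0)) (z (Fin.natAdd n 1))) &&
            (xor (d₁ fun i => z (Fin.castAdd 2 i)) (d₂ fun i => z (Fin.castAdd 2 i)))))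
          (z (Fin.natAdd n 0) && z (Fin.natAdd n 1))) := by
  rw [bb_W_concat, h₁, h₂]
  generalize z (Fin.natAdd n 0) = a
  generalize z (Fin.natAdd n 1) = b
  cases a <;> cases b <;> cases d₁ (fun i => z (Fin.castAdd 2 i)) <;>
    cases d₂ (fun i => z (Fin.castAdd 2 i)) <;> simp [signOf] <;> ring

end Summit.QuantumAdvantage.QuantumAdvantage.Theorems.CubicForrelation.NearExactIsExact
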